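import Summits.HodgeConjecture.CorCM.Census.DecicWeil23Multi
import Mathlib.GroupTheory.Perm.Basic
import HarnessLib

/-!
# An octic `(1,3)`-FOURFOLD `B₄` and a decic `(2,3)`-FIVEFOLD `B₅` over TWO CM fields `K₂ ⊇ k ⊆ K₃` sharing the imaginary
# quadratic field `k`: `E × B₄ × B₅` — the finite model of the balanced weights of every product of copies, the two types read
# through an ARBITRARY pair of permutations of the conjugate pairs

COR-CM (cell `pub-hodgecm2`), seat b30 gen 27 (2026-08-23); count-neutral own lane OCTIC-DECIC = the degree-`(8,10)` member of the
two-field family `Census/SexticOcticWeil*` (`(6,8)`, gen 26), `Census/SexticDecicWeil*` (`(6,10)`, gen 27): ONE curve slot `E` (CM by `k`),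
ONE FOURFOLD slot `B₄` (CM by an OCTIC field `K₂ ⊇ i₂(k)`, type of `k`-signature `(1,3)`: exactly one embedding over `τ`) and ONE FIVEFOLD
slot `B₅` (CM by a DECIC field `K₃ ⊇ i₃(k)`, type of `k`-signature `(2,3)`: exactly two embeddings over `τ`).  Bookkeeping definitions and
theorems of a finite model; no named fact, no geometry, no `sorry`, no `decide`.

SETTING (formalised downstream, `CorCM/OcticDecicWeilFrameTransfer`).  Frames `e₂ : Hom(K₂, ℂ) ≃ Fin 4 × Bool`,
`e₃ : Hom(K₃, ℂ) ≃ Fin 5 × Bool` (`(e_m s).2 = [s ∘ i_m = τ]`, `e_m s̄ = ((e_m s).1, ¬(e_m s).2)`) reading the fourfold type as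
`s ∈ Φ₂ ⟺ (e₂ s).2 = [(e₂ s).1 = 0]` (the member over `τ` at position `0`) and the fivefold type as
`t ∈ Φ₃ ⟺ (e₃ t).2 = [(e₃ t).1 ∈ {0, 1}]` (the two members over `τ` at the positions `0, 1`); `R ⊆ Sym(4) × Sym(5)` the PAIRS of
permutations of the conjugate pairs of `K₂` and of `K₃` induced by ONE automorphism of `ℂ` fixing `τ`.

MODEL.  `PtOD = Bool ⊕ ((Fin 4 × Bool) ⊕ (Fin 5 × Bool))` (`inl b` = the embedding `τ_b` of `k`; `inr (inl (a, b))` = the embedding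
of `K₂` of sign `b` in the pair `a`; `inr (inr (a, b))` = the same for `K₃`); `phiOD π = {inl true} ⊔ {inr (inl (a, [π.1 a = 0]))} ⊔
{inr (inr (a, [π.2 a ∈ {0,1}]))} = π⁻¹(types)`; `ModelBalancedOD R v T`: the equations `2 · #{x ∈ T | v x ∈ phiOD π} = |T|`, `π ∈ R`.

RESULTS (kernel).  `cjOD` (conjugation), membership, `phiOD_eq`, `mem_phiOD_iff_cjOD_not_mem` (each `phiOD π` is a CM type of the
model), counting fibrewise, and **the signed form** `balancedOD_iff_signed` of the equation at `π`:
`(N t − N f) + Σ_a ± d₂(a) + Σ_b ± d₃(b) = 0` (`d₂(a) = N(1,a,t) − N(1,a,f)`, sign `+` iff `π.1 a = 0`; `d₃(b) = N(2,b,t) − N(2,b,f)`,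
sign `+` iff `π.2 b ∈ {0, 1}`).  THE DEFECT LAW (from a realised ROTATION of the five decic pairs and transitivity on the four octic
pairs — both automatic downstream) is the sequel `Census/OcticDecicWeilDefect.lean`; parts, extraction and induction follow in
`Census/OcticDecicWeil{Parts,PartsBalanced,Extraction}`.
[cite: Pohlmann1968, Thm 1] [cite: GaoUllmo2025, Thm 3.1] [cite: MoonenZarhin1995Duke, Thm. 2.4] [cite: Gordon1999HodgeAVSurvey, 5.13 (ii), 9.2.2]

## References
* [Pohlmann1968] H. Pohlmann, Ann. of Math. 88 (1968), Thm 1.  [GaoUllmo2025] Z. Gao, E. Ullmo, J. Inst. Math. Jussieu 25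
  (2025), Thm 3.1.  [MoonenZarhin1995Duke] B. Moonen, Yu. Zarhin, Duke Math. J. 77 (1995), Thm. 2.4.  [Gordon1999HodgeAVSurvey]
  B. B. Gordon, CRM Monogr. 10 (1999), 5.13 (ii), 9.2.2.

## Provenance
Exact python first (seat folder `work/scratch/census810.py`): `20` unknowns; under `S₄ × S₅`, under EVERY `C₄ × C₅` (all `24` five-cycles,
type pairs at `{0,1}`) and under random «rotation-stable + octic-transitive» realised sets the balanced lattice of every product of copies of
`E, B₄, B₅` has nullity `12 = 10` conjugate pairs `+ 2` (`t₂, t₃`), with the defect law `d₂ ≡ t₂`, `d₃ ≡ t₃`, `e = 2t₂ + t₃`, and every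
reduced balanced weight is a disjoint union of Weil SIXFOLD (`B₄ × E × E`, `B₅ × E`), TENFOLD (`E × B₄ × B̄₅`) and FOURTEENFOLD
(`B₄ × B̄₅ × B̄₅`) weights.
-/

namespace Summit.HodgeConjecture.CorCM.Census.OcticDecicWeil

open Finset

/-! ### The model -/

/-- Points: `inl b` = embedding of `k` of sign `b`; `inr (inl (a, b))` = embedding of the octic field `K₂` of sign `b` in the
pair `a < 4` (fourfold slot); `inr (inr (a, b))` = embedding of the decic field `K₃` of sign `b` in the pair `a < 5` (fivefold slot).
[cite: GaoUllmo2025, §2.1] -/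
abbrev PtOD : Type := Bool ⊕ ((Fin 4 × Bool) ⊕ (Fin 5 × Bool))

/-- Complex conjugation on the model: the sign flips. [folklore] -/
def cjOD : PtOD → PtOD
  | Sum.inl b => Sum.inl (!b)
  | Sum.inr (Sum.inl (a, b)) => Sum.inr (Sum.inl (a, !b))
  | Sum.inr (Sum.inr (a, b)) => Sum.inr (Sum.inr (a, !b))

/-- Unfolding of `cjOD`, curve slot. [folklore] -/
theorem cjOD_inl (b : Bool) : cjOD (Sum.inl b) = Sum.inl (!b) := rfl

/-- Unfolding of `cjOD`, fourfold slot. [folklore] -/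
theorem cjOD_inr_inl (a : Fin 4) (b : Bool) : cjOD (Sum.inr (Sum.inl (a, b))) = Sum.inr (Sum.inl (a, !b)) := rfl

/-- Unfolding of `cjOD`, fivefold slot. [folklore] -/
theorem cjOD_inr_inr (a : Fin 5) (b : Bool) : cjOD (Sum.inr (Sum.inr (a, b))) = Sum.inr (Sum.inr (a, !b)) := rfl

/-- `cjOD` is an involution. [folklore] -/
theorem cjOD_cjOD (y : PtOD) : cjOD (cjOD y) = y := by
  rcases y with b | ⟨⟨a, b⟩ | ⟨a, b⟩⟩
  · rw [cjOD_inl, cjOD_inl, Bool.not_not]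
  · rw [cjOD_inr_inl, cjOD_inr_inl, Bool.not_not]
  · rw [cjOD_inr_inr, cjOD_inr_inr, Bool.not_not]

/-- `cjOD` has no fixed point. [folklore] -/
theorem cjOD_ne (y : PtOD) : cjOD y ≠ y := by
  rcases y with b | ⟨⟨a, b⟩ | ⟨a, b⟩⟩
  · rw [cjOD_inl]; cases b <;> simp
  · rw [cjOD_inr_inl]; cases b <;> simp
  · rw [cjOD_inr_inr]; cases b <;> simp

/-- `cjOD` is injective. [folklore] -/
theorem cjOD_injective : Function.Injective cjOD := fun y y' h => by rw [← cjOD_cjOD y, h, cjOD_cjOD]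

/-- **`π⁻¹(types)` read in the model** (Boolean form): the fourfold type is positive exactly at the pair `π.1⁻¹ 0`, the fivefold
type exactly at the two pairs `π.2⁻¹ {0, 1}`, the curve type is `{τ}`. [cite: GaoUllmo2025, Thm 3.1 (3.2)] -/
def inPhiOD (π : Equiv.Perm (Fin 4) × Equiv.Perm (Fin 5)) : PtOD → Bool
  | Sum.inl b => b
  | Sum.inr (Sum.inl (a, b)) => b == decide (π.1 a = 0)
  | Sum.inr (Sum.inr (a, b)) => b == decide (π.2 a = 0 ∨ π.2 a = 1)

/-- `π⁻¹(types)` as a finset of the model. [cite: GaoUllmo2025, Thm 3.1 (3.2)] -/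
def phiOD (π : Equiv.Perm (Fin 4) × Equiv.Perm (Fin 5)) : Finset PtOD := univ.filter fun y => inPhiOD π y = true

variable (π : Equiv.Perm (Fin 4) × Equiv.Perm (Fin 5))

/-- Membership, curve slot. [folklore] -/
theorem inl_mem_phiOD (b : Bool) : Sum.inl b ∈ phiOD π ↔ b = true := by
  simp [phiOD, inPhiOD]

/-- Membership, fourfold slot. [folklore] -/
theorem inr_inl_mem_phiOD (a : Fin 4) (b : Bool) : Sum.inr (Sum.inl (a, b)) ∈ phiOD π ↔ b = decide (π.1 a = 0) := by
  simp only [phiOD, inPhiOD, Finset.mem_filter, Finset.mem_univ, true_and, beq_iff_eq]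

/-- Membership, fivefold slot. [folklore] -/
theorem inr_inr_mem_phiOD (a : Fin 5) (b : Bool) : Sum.inr (Sum.inr (a, b)) ∈ phiOD π ↔ b = decide (π.2 a = 0 ∨ π.2 a = 1) := by
  simp only [phiOD, inPhiOD, Finset.mem_filter, Finset.mem_univ, true_and, beq_iff_eq]

/-- Each `phiOD π` is a CM type of the model: it contains exactly one of `y`, `cjOD y`. [folklore] -/
theorem mem_phiOD_iff_cjOD_not_mem (y : PtOD) : y ∈ phiOD π ↔ cjOD y ∉ phiOD π := by
  rcases y with b | ⟨⟨a, b⟩ | ⟨a, b⟩⟩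
  · rw [cjOD_inl, inl_mem_phiOD, inl_mem_phiOD]
    cases b <;> simp
  · rw [cjOD_inr_inl, inr_inl_mem_phiOD, inr_inl_mem_phiOD]
    cases b <;> cases decide (π.1 a = 0) <;> simp
  · rw [cjOD_inr_inr, inr_inr_mem_phiOD, inr_inr_mem_phiOD]
    cases b <;> cases decide (π.2 a = 0 ∨ π.2 a = 1) <;> simp

/-- `phiOD π` as an explicit finset: `{inl true} ⊔ {inr (inl (a, [π.1 a = 0]))} ⊔ {inr (inr (a, [π.2 a ∈ {0,1}]))}`. [folklore] -/
theorem phiOD_eq : phiOD π =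
    insert (Sum.inl true)
      (((univ : Finset (Fin 4)).image fun a => (Sum.inr (Sum.inl (a, decide (π.1 a = 0))) : PtOD)) ∪
        ((univ : Finset (Fin 5)).image fun a => (Sum.inr (Sum.inr (a, decide (π.2 a = 0 ∨ π.2 a = 1))) : PtOD))) := by
  ext y
  rw [Finset.mem_insert, Finset.mem_union, Finset.mem_image, Finset.mem_image]
  rcases y with b | ⟨⟨a, b⟩ | ⟨a, b⟩⟩
  · rw [inl_mem_phiOD]
    constructor
    · rintro rfl
      exact Or.inl rfl
    · rintro (h | ⟨q, -, hq⟩ | ⟨q, -, hq⟩)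
      · exact Sum.inl_injective h
      · exact absurd hq Sum.inr_ne_inl
      · exact absurd hq Sum.inr_ne_inl
  · rw [inr_inl_mem_phiOD]
    constructor
    · rintro rfl
      exact Or.inr (Or.inl ⟨a, Finset.mem_univ _, rfl⟩)
    · rintro (h | ⟨a', -, hq⟩ | ⟨a', -, hq⟩)
      · exact absurd h Sum.inr_ne_inl
      · simp only [Sum.inr.injEq, Sum.inl.injEq, Prod.mk.injEq] at hq
        obtain ⟨rfl, rfl⟩ := hq
        rfl
      · simp only [Sum.inr.injEq] at hq
        exact absurd hq Sum.inr_ne_inl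
  · rw [inr_inr_mem_phiOD]
    constructor
    · rintro rfl
      exact Or.inr (Or.inr ⟨a, Finset.mem_univ _, rfl⟩)
    · rintro (h | ⟨a', -, hq⟩ | ⟨a', -, hq⟩)
      · exact absurd h Sum.inr_ne_inl
      · simp only [Sum.inr.injEq] at hq
        exact absurd hq Sum.inl_ne_inr
      · simp only [Sum.inr.injEq, Prod.mk.injEq] at hq
        obtain ⟨rfl, rfl⟩ := hq
        rfl

/-! ### Balanced configurations -/

variable {α : Type*}

/-- **Pohlmann's condition for a configuration** of a product of copies of `E, B₄, B₅` under a set `R` of realised pairs of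
permutations of the conjugate pairs: `2 · #{x ∈ T | v x ∈ π⁻¹(types)} = |T|` for `π ∈ R`. [cite: GaoUllmo2025, Thm 3.1 eq. (3.2)]
[cite: Pohlmann1968, Thm 1] -/
def ModelBalancedOD (R : Finset (Equiv.Perm (Fin 4) × Equiv.Perm (Fin 5))) (v : α → PtOD) (T : Finset α) : Prop :=
  ∀ π ∈ R, 2 * (T.filter fun x => v x ∈ phiOD π).card = T.card

variable (R : Finset (Equiv.Perm (Fin 4) × Equiv.Perm (Fin 5))) (v : α → PtOD)

/-- The empty configuration is balanced. [folklore] -/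
theorem modelBalancedOD_empty : ModelBalancedOD R v (∅ : Finset α) := fun _ _ => by simp

variable {R v}

/-- **Removing a balanced part keeps the balance.** [folklore] -/
theorem ModelBalancedOD.sdiff [DecidableEq α] {T G : Finset α} (hT : ModelBalancedOD R v T) (hG : ModelBalancedOD R v G)
    (hGT : G ⊆ T) : ModelBalancedOD R v (T \ G) := by
  intro π hπ
  have key : ∀ (Q : α → Prop) [DecidablePred Q],
      ((T \ G).filter Q).card = (T.filter Q).card - (G.filter Q).card := by
    intro Q _
    rw [← Finset.card_sdiff_of_subset (Finset.filter_subset_filter Q hGT)]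
    congr 1
    ext x
    simp only [Finset.mem_filter, Finset.mem_sdiff]
    tauto
  have h1 := hT π hπ
  have h2 := hG π hπ
  have h3 := Finset.card_sdiff_of_subset hGT
  have h4 : (G.filter fun x => v x ∈ phiOD π).card ≤ (T.filter fun x => v x ∈ phiOD π).card :=
    Finset.card_le_card (Finset.filter_subset_filter _ hGT)
  rw [key, h3]
  omega

/-- **A disjoint union of balanced configurations is balanced.** [folklore] -/
theorem ModelBalancedOD.union [DecidableEq α] {G S : Finset α} (hG : ModelBalancedOD R v G) (hS : ModelBalancedOD R v S)
    (hGS : Disjoint G S) : ModelBalancedOD R v (G ∪ S) := by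
  intro π hπ
  rw [Finset.filter_union, Finset.card_union_of_disjoint (Finset.disjoint_filter_filter hGS),
    Finset.card_union_of_disjoint hGS, mul_add, hG π hπ, hS π hπ]

/-! ### Counting fibrewise; the signed form -/

variable (v)

/-- `#{x ∈ T | v x ∈ W} = Σ_{y ∈ W} #{x ∈ T | v x = y}`. [folklore] -/
theorem card_filter_mem_eq_sumOD (T : Finset α) (W : Finset PtOD) :
    (T.filter fun x => v x ∈ W).card = ∑ y ∈ W, (T.filter fun x => v x = y).card := by
  rw [Finset.card_eq_sum_card_fiberwise (f := v) (s := T.filter fun x => v x ∈ W) (t := W)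
    (fun x hx => (Finset.mem_filter.1 (Finset.mem_coe.1 hx)).2)]
  refine Finset.sum_congr rfl fun y hy => ?_
  congr 1
  ext x
  simp only [Finset.mem_filter]
  constructor
  · rintro ⟨⟨hx, -⟩, hxy⟩; exact ⟨hx, hxy⟩
  · rintro ⟨hx, hxy⟩; exact ⟨⟨hx, hxy ▸ hy⟩, hxy⟩

/-- `|T| = Σ_y #{x ∈ T | v x = y}`. [folklore] -/
theorem card_eq_sumOD (T : Finset α) : T.card = ∑ y : PtOD, (T.filter fun x => v x = y).card := by
  rw [← card_filter_mem_eq_sumOD v T univ]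
  congr 1
  ext x
  simp

/-- A sum over the model, expanded by slots. [folklore] -/
theorem sum_ptOD (N : PtOD → ℕ) : ∑ y : PtOD, N y =
    N (Sum.inl true) + N (Sum.inl false) +
      (∑ a : Fin 4, (N (Sum.inr (Sum.inl (a, true))) + N (Sum.inr (Sum.inl (a, false)))) +
        ∑ a : Fin 5, (N (Sum.inr (Sum.inr (a, true))) + N (Sum.inr (Sum.inr (a, false))))) := by
  rw [Fintype.sum_sum_type, Fintype.sum_bool, Fintype.sum_sum_type, Fintype.sum_prod_type, Fintype.sum_prod_type]
  simp only [Fintype.sum_bool]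

/-- The sum over `phiOD π`, expanded. [folklore] -/
theorem sum_phiOD (N : PtOD → ℕ) :
    ∑ y ∈ phiOD π, N y = N (Sum.inl true) +
      (∑ a : Fin 4, N (Sum.inr (Sum.inl (a, decide (π.1 a = 0)))) + ∑ a : Fin 5, N (Sum.inr (Sum.inr (a, decide (π.2 a = 0 ∨ π.2 a = 1))))) := by
  rw [phiOD_eq π]
  have hinj₁ : Function.Injective fun a : Fin 4 => (Sum.inr (Sum.inl (a, decide (π.1 a = 0))) : PtOD) := by
    intro a a' h
    simp only [Sum.inr.injEq, Sum.inl.injEq, Prod.mk.injEq] at h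
    exact h.1
  have hinj₂ : Function.Injective fun a : Fin 5 => (Sum.inr (Sum.inr (a, decide (π.2 a = 0 ∨ π.2 a = 1))) : PtOD) := by
    intro a a' h
    simp only [Sum.inr.injEq, Prod.mk.injEq] at h
    exact h.1
  have hdisj : Disjoint ((univ : Finset (Fin 4)).image fun a => (Sum.inr (Sum.inl (a, decide (π.1 a = 0))) : PtOD))
      ((univ : Finset (Fin 5)).image fun a => (Sum.inr (Sum.inr (a, decide (π.2 a = 0 ∨ π.2 a = 1))) : PtOD)) := by
    rw [Finset.disjoint_left]
    intro y hy hy'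
    obtain ⟨a, -, rfl⟩ := Finset.mem_image.1 hy
    obtain ⟨a', -, h⟩ := Finset.mem_image.1 hy'
    simp only [Sum.inr.injEq] at h
    exact Sum.inr_ne_inl h
  have h1 : Sum.inl true ∉
      ((univ : Finset (Fin 4)).image fun a => (Sum.inr (Sum.inl (a, decide (π.1 a = 0))) : PtOD)) ∪
        ((univ : Finset (Fin 5)).image fun a => (Sum.inr (Sum.inr (a, decide (π.2 a = 0 ∨ π.2 a = 1))) : PtOD)) := by simp
  rw [Finset.sum_insert h1, Finset.sum_union hdisj, Finset.sum_image fun a _ a' _ h => hinj₁ h,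
    Finset.sum_image fun a _ a' _ h => hinj₂ h]

/-- **The signed form of the balance equation at `π`**: `2 Σ_{y ∈ phiOD π} N y = Σ_y N y` iff
`(N t − N f) + Σ_a ± d₂(a) + Σ_a ± d₃(a) = 0`, the signs being `+` iff `π.1 a = 0` resp. `π.2 a ∈ {0, 1}`. [cite: GaoUllmo2025, Thm 3.1] -/
theorem balancedOD_iff_signed (N : PtOD → ℕ) :
    2 * ∑ y ∈ phiOD π, N y = ∑ y : PtOD, N y ↔
      ((N (Sum.inl true) : ℤ) - N (Sum.inl false)) +
        (∑ a : Fin 4, (if π.1 a = 0 then ((N (Sum.inr (Sum.inl (a, true))) : ℤ) - N (Sum.inr (Sum.inl (a, false))))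
            else -(((N (Sum.inr (Sum.inl (a, true))) : ℤ) - N (Sum.inr (Sum.inl (a, false))))))) +
        (∑ a : Fin 5, (if (π.2 a = 0 ∨ π.2 a = 1) then ((N (Sum.inr (Sum.inr (a, true))) : ℤ) - N (Sum.inr (Sum.inr (a, false))))
            else -(((N (Sum.inr (Sum.inr (a, true))) : ℤ) - N (Sum.inr (Sum.inr (a, false))))))) = 0 := by
  rw [sum_phiOD, sum_ptOD]
  have key₁ : ∀ a : Fin 4, (2 * (N (Sum.inr (Sum.inl (a, decide (π.1 a = 0)))) : ℤ)) =
      ((N (Sum.inr (Sum.inl (a, true))) : ℤ) + N (Sum.inr (Sum.inl (a, false)))) +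
        (if π.1 a = 0 then ((N (Sum.inr (Sum.inl (a, true))) : ℤ) - N (Sum.inr (Sum.inl (a, false))))
          else -(((N (Sum.inr (Sum.inl (a, true))) : ℤ) - N (Sum.inr (Sum.inl (a, false)))))) := by
    intro a
    by_cases h : π.1 a = 0
    · rw [decide_eq_true h, if_pos h]; ring
    · rw [decide_eq_false h, if_neg h]; ring
  have key₂ : ∀ a : Fin 5, (2 * (N (Sum.inr (Sum.inr (a, decide (π.2 a = 0 ∨ π.2 a = 1)))) : ℤ)) =
      ((N (Sum.inr (Sum.inr (a, true))) : ℤ) + N (Sum.inr (Sum.inr (a, false)))) +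
        (if (π.2 a = 0 ∨ π.2 a = 1) then ((N (Sum.inr (Sum.inr (a, true))) : ℤ) - N (Sum.inr (Sum.inr (a, false))))
          else -(((N (Sum.inr (Sum.inr (a, true))) : ℤ) - N (Sum.inr (Sum.inr (a, false)))))) := by
    intro a
    by_cases h : (π.2 a = 0 ∨ π.2 a = 1)
    · rw [decide_eq_true h, if_pos h]; ring
    · rw [decide_eq_false h, if_neg h]; ring
  have hsum₁ : (2 * (∑ a : Fin 4, N (Sum.inr (Sum.inl (a, decide (π.1 a = 0))))) : ℤ) =
      (∑ a : Fin 4, (((N (Sum.inr (Sum.inl (a, true))) : ℤ) + N (Sum.inr (Sum.inl (a, false)))))) +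
        ∑ a : Fin 4, (if π.1 a = 0 then ((N (Sum.inr (Sum.inl (a, true))) : ℤ) - N (Sum.inr (Sum.inl (a, false))))
          else -(((N (Sum.inr (Sum.inl (a, true))) : ℤ) - N (Sum.inr (Sum.inl (a, false)))))) := by
    push_cast
    rw [Finset.mul_sum, ← Finset.sum_add_distrib]
    exact Finset.sum_congr rfl fun a _ => key₁ a
  have hsum₂ : (2 * (∑ a : Fin 5, N (Sum.inr (Sum.inr (a, decide (π.2 a = 0 ∨ π.2 a = 1))))) : ℤ) =
      (∑ a : Fin 5, (((N (Sum.inr (Sum.inr (a, true))) : ℤ) + N (Sum.inr (Sum.inr (a, false)))))) +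
        ∑ a : Fin 5, (if (π.2 a = 0 ∨ π.2 a = 1) then ((N (Sum.inr (Sum.inr (a, true))) : ℤ) - N (Sum.inr (Sum.inr (a, false))))
          else -(((N (Sum.inr (Sum.inr (a, true))) : ℤ) - N (Sum.inr (Sum.inr (a, false)))))) := by
    push_cast
    rw [Finset.mul_sum, ← Finset.sum_add_distrib]
    exact Finset.sum_congr rfl fun a _ => key₂ a
  constructor
  · intro h
    have hz : (2 : ℤ) * ((N (Sum.inl true) : ℤ) +
        (((∑ a : Fin 4, N (Sum.inr (Sum.inl (a, decide (π.1 a = 0))))) : ℕ) +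
          ((∑ a : Fin 5, N (Sum.inr (Sum.inr (a, decide (π.2 a = 0 ∨ π.2 a = 1))))) : ℕ) : ℤ)) =
        (N (Sum.inl true) : ℤ) + N (Sum.inl false) +
          (((∑ a : Fin 4, (N (Sum.inr (Sum.inl (a, true))) + N (Sum.inr (Sum.inl (a, false))))) : ℕ) +
            ((∑ a : Fin 5, (N (Sum.inr (Sum.inr (a, true))) + N (Sum.inr (Sum.inr (a, false))))) : ℕ) : ℤ) := by
      exact_mod_cast h
    push_cast at hz hsum₁ hsum₂
    linarith
  · intro h
    have hz : (2 : ℤ) * ((N (Sum.inl true) : ℤ) +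
        (((∑ a : Fin 4, N (Sum.inr (Sum.inl (a, decide (π.1 a = 0))))) : ℕ) +
          ((∑ a : Fin 5, N (Sum.inr (Sum.inr (a, decide (π.2 a = 0 ∨ π.2 a = 1))))) : ℕ) : ℤ)) =
        (N (Sum.inl true) : ℤ) + N (Sum.inl false) +
          (((∑ a : Fin 4, (N (Sum.inr (Sum.inl (a, true))) + N (Sum.inr (Sum.inl (a, false))))) : ℕ) +
            ((∑ a : Fin 5, (N (Sum.inr (Sum.inr (a, true))) + N (Sum.inr (Sum.inr (a, false))))) : ℕ) : ℤ) := by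
      push_cast at hsum₁ hsum₂ ⊢
      linarith
    exact_mod_cast hz

variable {π} (R)

/-- **The defect of a configuration balanced under `R`, at `π ∈ R`** (the signed equation for the fibre counts
`N y = #{x ∈ T | v x = y}`). [cite: GaoUllmo2025, Thm 3.1] -/
theorem signed_of_modelBalancedOD {T : Finset α} (hT : ModelBalancedOD R v T) {π : Equiv.Perm (Fin 4) × Equiv.Perm (Fin 5)}
    (hπ : π ∈ R) :
    (((T.filter fun x => v x = Sum.inl true).card : ℤ) - (T.filter fun x => v x = Sum.inl false).card) +
      (∑ a : Fin 4, (if π.1 a = 0 then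
        (((T.filter fun x => v x = Sum.inr (Sum.inl (a, true))).card : ℤ) -
          (T.filter fun x => v x = Sum.inr (Sum.inl (a, false))).card)
        else -((((T.filter fun x => v x = Sum.inr (Sum.inl (a, true))).card : ℤ) -
          (T.filter fun x => v x = Sum.inr (Sum.inl (a, false))).card)))) +
      (∑ a : Fin 5, (if (π.2 a = 0 ∨ π.2 a = 1) then
        (((T.filter fun x => v x = Sum.inr (Sum.inr (a, true))).card : ℤ) -
          (T.filter fun x => v x = Sum.inr (Sum.inr (a, false))).card)
        else -((((T.filter fun x => v x = Sum.inr (Sum.inr (a, true))).card : ℤ) -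
          (T.filter fun x => v x = Sum.inr (Sum.inr (a, false))).card)))) = 0 := by
  rw [← balancedOD_iff_signed π fun y => (T.filter fun x => v x = y).card, ← card_filter_mem_eq_sumOD, ← card_eq_sumOD v T]
  exact hT π hπ

/-- **Conversely: a configuration whose fibre counts satisfy the signed equation at `π` is balanced at `π`.** [folklore] -/
theorem balancedOD_of_signed {T : Finset α} {π : Equiv.Perm (Fin 4) × Equiv.Perm (Fin 5)}
    (h : (((T.filter fun x => v x = Sum.inl true).card : ℤ) - (T.filter fun x => v x = Sum.inl false).card) +
      (∑ a : Fin 4, (if π.1 a = 0 then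
        (((T.filter fun x => v x = Sum.inr (Sum.inl (a, true))).card : ℤ) -
          (T.filter fun x => v x = Sum.inr (Sum.inl (a, false))).card)
        else -((((T.filter fun x => v x = Sum.inr (Sum.inl (a, true))).card : ℤ) -
          (T.filter fun x => v x = Sum.inr (Sum.inl (a, false))).card)))) +
      (∑ a : Fin 5, (if (π.2 a = 0 ∨ π.2 a = 1) then
        (((T.filter fun x => v x = Sum.inr (Sum.inr (a, true))).card : ℤ) -
          (T.filter fun x => v x = Sum.inr (Sum.inr (a, false))).card)
        else -((((T.filter fun x => v x = Sum.inr (Sum.inr (a, true))).card : ℤ) -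
          (T.filter fun x => v x = Sum.inr (Sum.inr (a, false))).card)))) = 0) :
    2 * (T.filter fun x => v x ∈ phiOD π).card = T.card := by
  rw [card_filter_mem_eq_sumOD, card_eq_sumOD v T, balancedOD_iff_signed]
  exact h

end Summit.HodgeConjecture.CorCM.Census.OcticDecicWeil
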